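import Literature.RingTheory.FormalGroups.FunctionalEquationLemma
import Literature.NumberTheory.GaloisRepresentations.LubinTate
import Mathlib.RingTheory.Localization.Away.Basic
import Mathlib.Algebra.MvPolynomial.Expand
import Mathlib.Algebra.Order.Floor.Defs
import Mathlib.Data.Nat.Log
import HarnessLib

/-!
# The universal formal `𝒪`-module law, I: Hazewinkel's logarithm `f_S` over `𝒪[1/π][S₂,S₃,…]` and the integrality of
# `F_S(X,Y) = f_S⁻¹(f_S(X) + f_S(Y))`, `[a]_S(X) = f_S⁻¹(a·f_S(X))`  ([Hazewinkel 1978] §21.4–§21.5, (21.4.5)–(21.4.8); §25.1)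

Topic `Literature/RingTheory/FormalGroups`; namespace `Literature.RingTheory.FormalGroups.UnivOModule`.  DEFINITIONS (the data
of the construction) + fully proved theorems; no named fact, no instance, no notation, no `sorry`.  Cell `hodgecm-mathlib`, P6
«MOD programme» ROW 4B, letter L4B.3c𝒪 (lifting of formal `𝒪`-module laws along surjections), road «universal law by the
functional equation lemma» (desk F0P6d-plan, hand F0P6-p04).  Sequels: `UniversalFormalOModuleLaw.lean` (the law over
`𝒪[S]` as a ★ `FormalOModuleLaw`), `UniversalFormalOModuleLawTruncation.lean`.

THE CONSTRUCTION.  Let `𝒪` be a commutative ring with an element `π` and an integer `q ≥ 2` satisfying the Lubin–Tate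
hypotheses ★ `IsLTRing π q` (π a non-zero-divisor, `q = p^r` with `p ∈ π𝒪`, `a^q ≡ a (mod π)`; e.g. the integers of a local
field with uniformizer `π` and residue cardinality `q`).  Over `K = 𝒪[1/π][S₀,S₁,S₂,…]` (`MvPolynomial ℕ (Localization.Away π)`;
only the variables `S_n`, `n ≥ 2`, are used) let `σ` be the `𝒪[1/π]`-algebra endomorphism `S_n ↦ S_n^q` and put

  `g(X) = X + Σ_{n ≥ 2, n not a power of q} S_n X^n`,   `s_i = S_{q^i}/π`  (`i ≥ 1`),
  `f_S(X) = Σ a_n X^n`,  `a_n = g_n + Σ_{i ≥ 1, q^i ∣ n} s_i σ^i(a_{n/q^i})`   (Hazewinkel's functional equation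
  `f_S = g + Σ_i s_i σ^i_* f_S(X^{q^i})`, [Hazewinkel1978] (2.1.5)–(2.1.8), (21.4.5)),
  `F_S(X,Y) = f_S⁻¹(f_S(X) + f_S(Y))`,   `[a]_S(X) = f_S⁻¹(a · f_S(X))`  (`a ∈ 𝒪`).

By the functional equation lemma (★ `coeff_mem_of_feDefect_psubst_mem`, data `A = 𝒪[S] ≤ K`, `ϖ = π`, `σ`, `s_i`),
`F_S` and all `[a]_S` have coefficients in `𝒪[S]`: `coeff_lawK_mem`, `coeff_actK_mem`.  That `(F_S, [·]_S)` is a formal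
`𝒪`-module law and that it is universal for `𝒪` the integers of a local field ([Hazewinkel1978] Thm. 21.4.8 ∕ (21.5);
[Drinfeld1974] §1 Prop. 1.4) is the business of the sequels; here: §1 the setting and its functional-equation hypotheses, §2 the
coefficients `a_n` and `f_S`, §3 integrality.

## References
* M. Hazewinkel, *Formal Groups and Applications* (1978), Ch. I §2.1–§2.2 (functional equation lemma), Ch. IV §21.4
  (21.4.5)–(21.4.8) (the universal formal `A`-module `F^A_S`), §21.5, §25.1. [Hazewinkel1978]
* V. G. Drinfeld, *Elliptic modules*, Math. USSR-Sb. 23 (1974), §1 (formal `𝒪`-modules, `Λ_𝒪 ≅ 𝒪[g₁,g₂,…]`). [Drinfeld1974]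
-/

noncomputable section

open scoped Classical

namespace Literature.RingTheory.FormalGroups

namespace UnivOModule

open MvPowerSeries Literature.NumberTheory.GaloisRepresentations.LubinTate

universe u

variable {𝒪 : Type u} [CommRing 𝒪] (π : 𝒪) (q : ℕ)

/-! ## §1 The setting `𝒪[S] ≤ K = 𝒪[1/π][S]`, `σ`, `ϖ = π`, `s_i = S_{q^i}/π` -/

/-- The coefficient ring `K = 𝒪[1/π][S₀, S₁, S₂, …]` of the construction. [cite: Hazewinkel1978, §21.4 (21.4.5)] -/
abbrev KS : Type u := MvPolynomial ℕ (Localization.Away π)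

/-- The inclusion `𝒪[S] → K`. [cite: Hazewinkel1978, §21.4 (21.4.5)] -/
def incl : MvPolynomial ℕ 𝒪 →+* KS π := MvPolynomial.map (algebraMap 𝒪 (Localization.Away π))

/-- The subring `A = 𝒪[S]` of `K`. [cite: Hazewinkel1978, §21.4 (21.4.5)] -/
def intSubring : Subring (KS π) := (incl π).range

/-- The endomorphism `σ : S_n ↦ S_n^q` of `K` (identity on `𝒪[1/π]`). [cite: Hazewinkel1978, §21.4 (21.4.5)] -/
def frob : KS π →+* KS π := ((MvPolynomial.expand q : KS π →ₐ[Localization.Away π] KS π) : KS π →+* KS π)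

/-- The element `ϖ = π` of `K`. [cite: Hazewinkel1978, §21.4 (21.4.5)] -/
def unif : KS π := MvPolynomial.C (algebraMap 𝒪 (Localization.Away π) π)

/-- The element `1/π` of `K`. [cite: Hazewinkel1978, §21.4 (21.4.5)] -/
def unifInv : KS π := MvPolynomial.C (↑(IsLocalization.Away.algebraMap_isUnit (S := Localization.Away π) π).unit⁻¹)

/-- `s_i = S_{q^i}/π`. [cite: Hazewinkel1978, §21.4 (21.4.5)] -/
def sCoeff (i : ℕ) : KS π := unifInv π * MvPolynomial.X (q ^ i)

/-- `n` is a power `q^i`, `i ≥ 1` (for `q ≥ 2`: `n ≥ 2` and `q^{⌊log_q n⌋} = n`). [cite: Hazewinkel1978, §21.4 (21.4.5)] -/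
def IsQPow (n : ℕ) : Prop := 2 ≤ n ∧ q ^ Nat.log q n = n

/-- The coefficients of `g(X) = X + Σ_{n ≥ 2, n ∉ q^ℕ} S_n X^n`. [cite: Hazewinkel1978, §21.4 (21.4.5)] -/
def gCoeff (n : ℕ) : KS π := if n = 1 then 1 else if 2 ≤ n ∧ ¬ IsQPow q n then MvPolynomial.X n else 0

/-! ### The hypotheses of the functional equation lemma -/

section Hypotheses

variable {π q}

/-- `π * (1/π) = 1` in `K`. [cite: Hazewinkel1978, §21.4 (21.4.5)] -/
theorem unif_mul_unifInv : unif π * unifInv π = 1 := by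
  rw [unif, unifInv, ← map_mul, IsUnit.mul_val_inv, map_one]

/-- `incl` is injective when `π` is a non-zero-divisor. [cite: Hazewinkel1978, §21.4 (21.4.5)] -/
theorem incl_injective (hA : IsLTRing π q) : Function.Injective (incl π) := by
  apply MvPolynomial.map_injective
  refine IsLocalization.injective (M := Submonoid.powers π) (Localization.Away π) ?_
  rw [Submonoid.powers_le]
  exact mem_nonZeroDivisors_iff.mpr ⟨hA.eq_zero_of_mul_eq_zero, fun x hx => hA.eq_zero_of_mul_eq_zero x
    (by rwa [mul_comm] at hx)⟩

/-- Membership in `A = 𝒪[S]`. [cite: Hazewinkel1978, §21.4 (21.4.5)] -/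
theorem mem_intSubring_iff {x : KS π} : x ∈ intSubring π ↔ ∃ y, incl π y = x := by
  rw [intSubring, RingHom.mem_range]

/-- `incl` commutes with `σ` (`σ` restricts to `S_n ↦ S_n^q` on `𝒪[S]`). [cite: Hazewinkel1978, §21.4 (21.4.5)] -/
theorem frob_incl (y : MvPolynomial ℕ 𝒪) : frob π q (incl π y) = incl π (MvPolynomial.expand q y) := by
  rw [frob, incl, RingHom.coe_coe]
  change MvPolynomial.expand q (MvPolynomial.map _ y) = _
  rw [MvPolynomial.map_expand]

/-- `σ(A) ⊆ A`. [cite: Hazewinkel1978, §21.4 (2.1.2)] -/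
theorem frob_mem {x : KS π} (hx : x ∈ intSubring π) : frob π q x ∈ intSubring π := by
  obtain ⟨y, rfl⟩ := mem_intSubring_iff.mp hx
  rw [frob_incl]
  exact mem_intSubring_iff.mpr ⟨_, rfl⟩

/-- `σ` fixes the constants `𝒪[1/π]`. [cite: Hazewinkel1978, §21.4 (2.1.2)] -/
theorem frob_C (c : Localization.Away π) : frob π q (MvPolynomial.C c) = MvPolynomial.C c := by
  rw [frob, RingHom.coe_coe, MvPolynomial.expand_C]

/-- `σ(S_n) = S_n^q`. [cite: Hazewinkel1978, §21.4 (2.1.2)] -/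
theorem frob_X (n : ℕ) : frob π q (MvPolynomial.X n) = MvPolynomial.X n ^ q := by
  rw [frob, RingHom.coe_coe, MvPolynomial.expand_X]

/-- `ϖ = π ∈ A`. [cite: Hazewinkel1978, §21.4 (2.1.3)] -/
theorem unif_mem : unif π ∈ intSubring π :=
  mem_intSubring_iff.mpr ⟨MvPolynomial.C π, by rw [incl, MvPolynomial.map_C]; rfl⟩

/-- `C(a) ∈ A` for `a ∈ 𝒪`. [cite: Hazewinkel1978, §21.4 (2.1.3)] -/
theorem C_algebraMap_mem (a : 𝒪) : MvPolynomial.C (algebraMap 𝒪 (Localization.Away π) a) ∈ intSubring π :=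
  mem_intSubring_iff.mpr ⟨MvPolynomial.C a, by rw [incl, MvPolynomial.map_C]⟩

/-- `S_n ∈ A`. [cite: Hazewinkel1978, §21.4 (2.1.3)] -/
theorem X_mem (n : ℕ) : (MvPolynomial.X n : KS π) ∈ intSubring π :=
  mem_intSubring_iff.mpr ⟨MvPolynomial.X n, by rw [incl, MvPolynomial.map_X]⟩

/-- `p ∈ ϖA`: `p = ϖ · w` with `w ∈ A`. [cite: Hazewinkel1978, §21.4 (2.1.3)] -/
theorem exists_natCast_eq_unif_mul (hA : IsLTRing π q) :
    ∃ p r : ℕ, p.Prime ∧ q = p ^ r ∧ ∃ w ∈ intSubring π, (p : KS π) = unif π * w := by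
  obtain ⟨p, r, hp, hqpr, hpmem⟩ := hA.exists_prime
  obtain ⟨w, hw⟩ := Ideal.mem_span_singleton'.mp hpmem
  refine ⟨p, r, hp, hqpr, MvPolynomial.C (algebraMap 𝒪 _ w), C_algebraMap_mem w, ?_⟩
  rw [unif, ← map_mul, ← map_mul, mul_comm, hw, map_natCast, map_natCast]

/-- `σ(a) ≡ a^q (mod ϖA)` on `A` (Frobenius on `(𝒪/π)[S]`: the coefficients satisfy `c^q ≡ c (mod π)`).
[cite: Hazewinkel1978, §21.4 (2.1.2)] -/
theorem exists_frob_eq_pow_add (hA : IsLTRing π q) {x : KS π} (hx : x ∈ intSubring π) :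
    ∃ b ∈ intSubring π, frob π q x = x ^ q + unif π * b := by
  obtain ⟨y, rfl⟩ := mem_intSubring_iff.mp hx
  -- over `𝒪[S]`: `expand q y - y^q ∈ π 𝒪[S]`, by reduction modulo `π`
  suffices h : ∃ b : MvPolynomial ℕ 𝒪, MvPolynomial.expand q y = y ^ q + MvPolynomial.C π * b by
    obtain ⟨b, hb⟩ := h
    refine ⟨incl π b, mem_intSubring_iff.mpr ⟨b, rfl⟩, ?_⟩
    rw [frob_incl, hb, map_add, map_pow, map_mul, incl, MvPolynomial.map_C]
    rfl
  -- the difference maps to `0` in `(𝒪/π)[S]`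
  set I : Ideal 𝒪 := Ideal.span {π} with hI
  have hq0 : q ≠ 0 := by
    obtain ⟨p, r, hp, hqpr, -⟩ := hA.exists_prime
    rw [hqpr]; exact pow_ne_zero _ hp.ne_zero
  have key : MvPolynomial.map (Ideal.Quotient.mk I) (MvPolynomial.expand q y - y ^ q) = 0 := by
    rw [map_sub, map_pow, MvPolynomial.map_expand, sub_eq_zero]
    -- `expand q ȳ = ȳ^q` over `𝒪/π`: compare with the power-series statement ★ `pow_eq_expand_of_isLTRing`
    have h := pow_eq_expand_of_isLTRing (σ := ℕ) hA hq0 (↑(MvPolynomial.map (Ideal.Quotient.mk I) y) :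
      MvPowerSeries ℕ (𝒪 ⧸ I))
    rw [← MvPolynomial.coe_pow, MvPowerSeries.expand_eq_expand, MvPolynomial.coe_inj] at h
    exact h.symm
  -- hence every coefficient is divisible by `π`, i.e. `C π ∣ expand q y - y^q`
  have hdvd : MvPolynomial.C π ∣ MvPolynomial.expand q y - y ^ q := by
    rw [MvPolynomial.C_dvd_iff_dvd_coeff]
    intro m
    have := congrArg (MvPolynomial.coeff m) key
    rwa [MvPolynomial.coeff_map, MvPolynomial.coeff_zero, Ideal.Quotient.eq_zero_iff_mem, hI,
      Ideal.mem_span_singleton] at this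
  obtain ⟨b, hb⟩ := hdvd
  exact ⟨b, by rw [← hb]; ring⟩

end Hypotheses

/-! ## §2 The logarithm `f_S = Σ a_n X^n` -/

/-- **The coefficients `a_n` of Hazewinkel's `f_S`**, by the recursion `a_0 = 0`,
`a_n = g_n + Σ_{1 ≤ i, q^i ∣ n} s_i σ^i(a_{n/q^i})` (the functional equation `f_S = g + Σ_i s_i σ^i_* f_S(X^{q^i})` read
coefficientwise).  (For `q ≤ 1` the recursion is cut off; the construction is only used for `q ≥ 2`.)
[cite: Hazewinkel1978, §21.4 (21.4.5)] -/
def logCoeff : ℕ → KS π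
  | 0 => 0
  | n + 1 => gCoeff π q (n + 1) + ∑ i ∈ (Finset.Icc 1 (n + 1)).attach,
      if _ : 2 ≤ q ∧ q ^ (i : ℕ) ∣ n + 1 then
        sCoeff π q i * (frob π q ^ (i : ℕ)) (logCoeff ((n + 1) / q ^ (i : ℕ)))
      else 0
decreasing_by
  have hi := (Finset.mem_Icc.mp i.2).1
  exact Nat.div_lt_self (Nat.succ_pos n) (Nat.one_lt_pow (by omega) (by omega))

/-- **Hazewinkel's `f_S(X) = Σ a_n X^n ∈ K⟦X⟧`.** [cite: Hazewinkel1978, §21.4 (21.4.5)] -/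
def logSeries : PowerSeries (KS π) := PowerSeries.mk (logCoeff π q)

section LogSeries

variable {π q}

/-- `a_0 = 0`. [cite: Hazewinkel1978, §21.4 (21.4.5)] -/
theorem logCoeff_zero : logCoeff π q 0 = 0 := by
  rw [logCoeff]

/-- The recursion for `a_n`, `n ≥ 1` (`q ≥ 2`): `a_n = g_n + Σ_{1 ≤ i ≤ n, q^i ∣ n} s_i σ^i(a_{n/q^i})`.
[cite: Hazewinkel1978, §21.4 (21.4.5)] -/
theorem logCoeff_of_pos (hq : 2 ≤ q) {n : ℕ} (hn : 1 ≤ n) : logCoeff π q n = gCoeff π q n +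
    ∑ i ∈ Finset.Icc 1 n, if q ^ i ∣ n then sCoeff π q i * (frob π q ^ i) (logCoeff π q (n / q ^ i)) else 0 := by
  obtain ⟨m, rfl⟩ : ∃ m, n = m + 1 := ⟨n - 1, by omega⟩
  rw [logCoeff]
  congr 1
  rw [← Finset.sum_attach (Finset.Icc 1 (m + 1)) (fun i => if q ^ i ∣ m + 1 then
    sCoeff π q i * (frob π q ^ i) (logCoeff π q ((m + 1) / q ^ i)) else 0)]
  refine Finset.sum_congr rfl fun i _ => ?_
  simp only [hq, true_and, dite_eq_ite]

/-- The coefficients of `f_S` are the `a_n`. [cite: Hazewinkel1978, §21.4 (21.4.5)] -/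
@[simp] theorem coeff_logSeries (n : ℕ) : PowerSeries.coeff n (logSeries π q) = logCoeff π q n := by
  rw [logSeries, PowerSeries.coeff_mk]

/-- `f_S(0) = 0`. [cite: Hazewinkel1978, §21.4 (21.4.5)] -/
theorem constantCoeff_logSeries : PowerSeries.constantCoeff (logSeries π q) = 0 := by
  rw [← PowerSeries.coeff_zero_eq_constantCoeff_apply, coeff_logSeries, logCoeff_zero]

/-- `g_1 = 1`, `g_0 = 0`. [cite: Hazewinkel1978, §21.4 (21.4.5)] -/
theorem gCoeff_one : gCoeff π q 1 = 1 := by simp [gCoeff]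

/-- `f_S ≡ X (mod deg 2)`: `a_1 = 1`. [cite: Hazewinkel1978, §21.4 (21.4.5)] -/
theorem coeff_one_logSeries (hq : 2 ≤ q) : PowerSeries.coeff 1 (logSeries π q) = 1 := by
  rw [coeff_logSeries, logCoeff_of_pos hq le_rfl, gCoeff_one, Finset.sum_eq_zero, add_zero]
  intro i hi
  rw [Finset.mem_Icc] at hi
  rw [if_neg]
  intro hdvd
  have : q ^ i ≤ 1 := Nat.le_of_dvd Nat.one_pos hdvd
  have : q ≤ q ^ i := by
    calc q = q ^ 1 := (pow_one q).symm
      _ ≤ q ^ i := Nat.pow_le_pow_right (by omega) hi.1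
  omega

/-- The coefficients of `(σ^i_* f_S)(X^{Q})`. [cite: Hazewinkel1978, §2.1 (2.1.6)] -/
theorem coeff_expand_map_logSeries {Q : ℕ} (hQ : Q ≠ 0) (i n : ℕ) :
    PowerSeries.coeff n (PowerSeries.expand Q hQ (PowerSeries.map (frob π q ^ i) (logSeries π q))) =
      if Q ∣ n then (frob π q ^ i) (logCoeff π q (n / Q)) else 0 := by
  rw [PowerSeries.coeff_expand]
  split_ifs with h
  · rw [PowerSeries.coeff_map, coeff_logSeries]
  · rfl

/-- **`f_S` is of functional-equation type**: its defect `a_n − Σ_{q^i ∣ n} s_i σ^i(a_{n/q^i})` is `g_n`.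
[cite: Hazewinkel1978, §21.4 (21.4.5)] -/
theorem feDefect_logSeries (hq : 2 ≤ q) (n : ℕ) :
    PowerSeries.coeff n (logSeries π q) - ∑ i ∈ Finset.Icc 1 n, sCoeff π q i *
      PowerSeries.coeff n (PowerSeries.expand (q ^ i) (pow_ne_zero i (by omega)) (PowerSeries.map (frob π q ^ i)
        (logSeries π q))) = gCoeff π q n := by
  rcases Nat.eq_zero_or_pos n with rfl | hn
  · simp [gCoeff, logCoeff_zero]
  · rw [coeff_logSeries, logCoeff_of_pos hq hn, add_sub_assoc, add_eq_left, sub_eq_zero]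
    refine Finset.sum_congr rfl fun i _ => ?_
    rw [coeff_expand_map_logSeries]
    split_ifs <;> simp

/-- `g_n ∈ A = 𝒪[S]`. [cite: Hazewinkel1978, §21.4 (21.4.5)] -/
theorem gCoeff_mem (n : ℕ) : gCoeff π q n ∈ intSubring π := by
  unfold gCoeff
  split_ifs
  · exact (intSubring π).one_mem
  · exact X_mem _
  · exact (intSubring π).zero_mem

/-- `σ^k(s_i) ϖ = S_{q^i}^{q^k} ∈ A`. [cite: Hazewinkel1978, §21.4 (2.1.4)] -/
theorem iterate_frob_sCoeff_mul_unif_mem (i k : ℕ) : (frob π q ^ k) (sCoeff π q i) * unif π ∈ intSubring π := by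
  have h1 : ∀ k : ℕ, (frob π q ^ k) (unifInv π) = unifInv π := fun k => by
    rw [RingHom.coe_pow]; exact Function.iterate_fixed (frob_C _) k
  have h2 : ∀ k : ℕ, (frob π q ^ k) (MvPolynomial.X (q ^ i)) = MvPolynomial.X (q ^ i) ^ (q ^ k) := fun k => by
    induction k with
    | zero => simp
    | succ k ih => rw [pow_succ', RingHom.coe_mul, Function.comp_apply, ih, map_pow, frob_X, ← pow_mul, ← pow_succ']
  rw [sCoeff, map_mul, h1, h2, mul_right_comm, mul_comm (unifInv π), unif_mul_unifInv, one_mul]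
  exact (intSubring π).pow_mem (X_mem _) _

end LogSeries

/-! ## §3 `F_S` and `[a]_S` over `K`, and their integrality -/

/-- The compositional inverse `f_S⁻¹` (`f_S ≡ X (mod deg 2)`). [cite: Hazewinkel1978, §21.4 (21.4.6)] -/
def expSeries (hq : 2 ≤ q) : PowerSeries (KS π) :=
  (logSeries π q).substInvOfIsUnit (by rw [coeff_one_logSeries hq]; exact isUnit_one)

/-- **`F_S(X,Y) = f_S⁻¹(f_S(X) + f_S(Y))`** over `K`. [cite: Hazewinkel1978, §21.4 (21.4.6)] -/
def lawK (hq : 2 ≤ q) : MvPowerSeries (Fin 2) (KS π) :=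
  PowerSeries.subst (PowerSeries.subst (MvPowerSeries.X 0 : MvPowerSeries (Fin 2) (KS π)) (logSeries π q) +
    PowerSeries.subst (MvPowerSeries.X 1 : MvPowerSeries (Fin 2) (KS π)) (logSeries π q)) (expSeries π q hq)

/-- **`[c]_S(X) = f_S⁻¹(c · f_S(X))`** over `K`, for a constant `c ∈ K`. [cite: Hazewinkel1978, §21.4 (21.4.7)] -/
def actK (hq : 2 ≤ q) (c : KS π) : PowerSeries (KS π) :=
  PowerSeries.subst (c • logSeries π q) (expSeries π q hq)

section Integrality

variable {π q}

/-- `f_S⁻¹(0) = 0`. [cite: Hazewinkel1978, §21.4 (21.4.6)] -/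
theorem constantCoeff_expSeries (hq : 2 ≤ q) : PowerSeries.constantCoeff (expSeries π q hq) = 0 :=
  PowerSeries.constantCoeff_substInvOfIsUnit _ _

/-- `f_S(f_S⁻¹(X)) = X`. [cite: Hazewinkel1978, §21.4 (21.4.6)] -/
theorem logSeries_subst_expSeries (hq : 2 ≤ q) : (logSeries π q).subst (expSeries π q hq) = PowerSeries.X :=
  PowerSeries.subst_substInvOfIsUnit_right _ constantCoeff_logSeries _

/-- `f_S⁻¹(f_S(X)) = X`. [cite: Hazewinkel1978, §21.4 (21.4.6)] -/
theorem expSeries_subst_logSeries (hq : 2 ≤ q) : (expSeries π q hq).subst (logSeries π q) = PowerSeries.X :=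
  PowerSeries.subst_substInvOfIsUnit_left _ constantCoeff_logSeries _

/-- `f_S(f_S⁻¹(w)) = w` for any substitutable `w`. [cite: Hazewinkel1978, §21.4 (21.4.6)] -/
theorem logSeries_subst_expSeries_subst (hq : 2 ≤ q) {υ : Type*} {w : MvPowerSeries υ (KS π)}
    (hw : MvPowerSeries.constantCoeff w = 0) :
    PowerSeries.subst (PowerSeries.subst w (expSeries π q hq)) (logSeries π q) = w := by
  rw [← PowerSeries.subst_comp_subst_apply (PowerSeries.HasSubst.of_constantCoeff_zero'
    (constantCoeff_expSeries hq)) (PowerSeries.HasSubst.of_constantCoeff_zero hw), logSeries_subst_expSeries hq,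
    PowerSeries.subst_X (PowerSeries.HasSubst.of_constantCoeff_zero hw)]

/-- `F_S(0,0) = 0`. [cite: Hazewinkel1978, §21.4 (21.4.6)] -/
theorem constantCoeff_lawK (hq : 2 ≤ q) : MvPowerSeries.constantCoeff (lawK π q hq) = 0 := by
  rw [lawK]
  apply PowerSeries.constantCoeff_subst_eq_zero _ _ (constantCoeff_expSeries hq)
  rw [map_add, PowerSeries.constantCoeff_subst_eq_zero (MvPowerSeries.constantCoeff_X 0) _ constantCoeff_logSeries,
    PowerSeries.constantCoeff_subst_eq_zero (MvPowerSeries.constantCoeff_X 1) _ constantCoeff_logSeries, add_zero]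

/-- `f_S(F_S(X,Y)) = f_S(X) + f_S(Y)`. [cite: Hazewinkel1978, §21.4 (21.4.6)] -/
theorem logSeries_subst_lawK (hq : 2 ≤ q) : PowerSeries.subst (lawK π q hq) (logSeries π q) =
    PowerSeries.subst (MvPowerSeries.X 0 : MvPowerSeries (Fin 2) (KS π)) (logSeries π q) +
      PowerSeries.subst (MvPowerSeries.X 1 : MvPowerSeries (Fin 2) (KS π)) (logSeries π q) := by
  rw [lawK]
  apply logSeries_subst_expSeries_subst hq
  rw [map_add, PowerSeries.constantCoeff_subst_eq_zero (MvPowerSeries.constantCoeff_X 0) _ constantCoeff_logSeries,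
    PowerSeries.constantCoeff_subst_eq_zero (MvPowerSeries.constantCoeff_X 1) _ constantCoeff_logSeries, add_zero]

/-- `[c]_S(0) = 0`. [cite: Hazewinkel1978, §21.4 (21.4.7)] -/
theorem constantCoeff_actK (hq : 2 ≤ q) (c : KS π) : PowerSeries.constantCoeff (actK π q hq c) = 0 := by
  rw [actK]
  apply PowerSeries.constantCoeff_subst_eq_zero _ _ (constantCoeff_expSeries hq)
  rw [MvPowerSeries.smul_eq_C_mul, map_mul]
  exact mul_eq_zero_of_right _ constantCoeff_logSeries

/-- `f_S([c]_S(X)) = c · f_S(X)`. [cite: Hazewinkel1978, §21.4 (21.4.7)] -/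
theorem logSeries_subst_actK (hq : 2 ≤ q) (c : KS π) :
    PowerSeries.subst (actK π q hq c) (logSeries π q) = c • logSeries π q := by
  rw [actK]
  apply logSeries_subst_expSeries_subst hq
  rw [MvPowerSeries.smul_eq_C_mul, map_mul]
  exact mul_eq_zero_of_right _ constantCoeff_logSeries

/-- The defect of `f_S` in one of several variables: that of `f_S(X_j)` at `d` is `g_{d_j}` on the `j`-axis and `0` off it.
[cite: Hazewinkel1978, §2.4] -/
theorem feDefect_logSeries_subst_X (hq : 2 ≤ q) {υ : Type*} (j : υ) (d : υ →₀ ℕ) :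
    feDefectCoeff (frob π q) q (by omega) (sCoeff π q)
      (PowerSeries.subst (MvPowerSeries.X j : MvPowerSeries υ (KS π)) (logSeries π q)) d =
      if d = Finsupp.single j (d j) then gCoeff π q (d j) else 0 := by
  classical
  have hq0 : q ≠ 0 := by omega
  have key : ∀ i : ℕ, MvPowerSeries.expand (q ^ i) (pow_ne_zero i hq0) (MvPowerSeries.map (frob π q ^ i)
      (PowerSeries.subst (MvPowerSeries.X j : MvPowerSeries υ (KS π)) (logSeries π q))) =
      PowerSeries.subst (MvPowerSeries.X j : MvPowerSeries υ (KS π))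
        (PowerSeries.expand (q ^ i) (pow_ne_zero i hq0) (PowerSeries.map (frob π q ^ i) (logSeries π q))) := by
    intro i
    have hX : PowerSeries.HasSubst (MvPowerSeries.X j : MvPowerSeries υ (KS π)) := PowerSeries.HasSubst.X j
    rw [PowerSeries.map_subst hX, MvPowerSeries.map_X, PowerSeries.expand_subst _ _ hX, MvPowerSeries.expand_X,
      PowerSeries.expand_apply, PowerSeries.subst_comp_subst_apply (PowerSeries.HasSubst.of_constantCoeff_zero'
        (by rw [map_pow, PowerSeries.constantCoeff_X, zero_pow (pow_ne_zero i hq0)])) hX]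
    congr 1
    rw [← PowerSeries.coe_substAlgHom hX, map_pow, PowerSeries.coe_substAlgHom, PowerSeries.subst_X hX]
  rw [feDefectCoeff_def, PowerSeries.coeff_subst_single]
  have hsum : (∑ i ∈ Finset.Icc 1 d.degree, sCoeff π q i * MvPowerSeries.coeff d (MvPowerSeries.expand (q ^ i)
      (pow_ne_zero i hq0) (MvPowerSeries.map (frob π q ^ i)
        (PowerSeries.subst (MvPowerSeries.X j : MvPowerSeries υ (KS π)) (logSeries π q))))) =
      ∑ i ∈ Finset.Icc 1 d.degree, sCoeff π q i * (if d = Finsupp.single j (d j) then PowerSeries.coeff (d j)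
        (PowerSeries.expand (q ^ i) (pow_ne_zero i hq0) (PowerSeries.map (frob π q ^ i) (logSeries π q))) else 0) :=
    Finset.sum_congr rfl fun i _ => by rw [key i, PowerSeries.coeff_subst_single]
  rw [hsum]
  split_ifs with hd
  · rw [← feDefect_logSeries hq (d j)]
    have hdeg : d.degree = d j := by rw [hd, Finsupp.degree_single]; simp
    rw [hdeg]
  · simp

/-- The defect of `f_S` itself (as a one-variable series) at `d` is `g_{|d|}`. [cite: Hazewinkel1978, §2.4] -/
theorem feDefect_logSeries' (hq : 2 ≤ q) (d : Unit →₀ ℕ) :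
    feDefectCoeff (frob π q) q (by omega) (sCoeff π q) (logSeries π q) d = gCoeff π q (d ()) := by
  classical
  have hd : d = Finsupp.single () (d ()) := Finsupp.ext fun u => by cases u; simp
  have h := feDefect_logSeries_subst_X (π := π) hq () d
  rw [show PowerSeries.subst (MvPowerSeries.X () : MvPowerSeries Unit (KS π)) (logSeries π q) = logSeries π q from
    PowerSeries.X_subst _, if_pos hd] at h
  exact h

/-- **Integrality of `F_S`**: all coefficients of `F_S(X,Y) = f_S⁻¹(f_S(X) + f_S(Y))` lie in `𝒪[S]` — the functional equation
lemma (i) for `f_S`. [cite: Hazewinkel1978, §21.4 (21.4.6), §2.2 (i)] -/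
theorem coeff_lawK_mem (hA : IsLTRing π q) (hq : 2 ≤ q) (d : Fin 2 →₀ ℕ) :
    MvPowerSeries.coeff d (lawK π q hq) ∈ intSubring π := by
  classical
  obtain ⟨p, r, hp, hqpr, w, hw, hpw⟩ := exists_natCast_eq_unif_mul hA
  have hr : 1 ≤ r := by
    rcases Nat.eq_zero_or_pos r with h | h
    · rw [h, pow_zero] at hqpr; omega
    · exact h
  refine coeff_mem_of_feDefect_psubst_mem (intSubring π) (frob π q) unif_mem hp hr (by omega) hqpr (sCoeff π q)
    ⟨w, hw, hpw⟩ (fun a ha => frob_mem ha) (fun a ha => exists_frob_eq_pow_add hA ha)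
    (fun i k _ => iterate_frob_sCoeff_mul_unif_mem i k) (logSeries π q) constantCoeff_logSeries (coeff_one_logSeries hq)
    (fun n => by rw [feDefect_logSeries hq n]; exact gCoeff_mem n) (constantCoeff_lawK hq) (fun e => ?_) d
  rw [logSeries_subst_lawK hq, feDefectCoeff_add, feDefect_logSeries_subst_X hq, feDefect_logSeries_subst_X hq]
  refine (intSubring π).add_mem ?_ ?_ <;> split_ifs <;> first | exact gCoeff_mem _ | exact (intSubring π).zero_mem

/-- **Integrality of `[a]_S`**: for `a ∈ 𝒪`, all coefficients of `[a]_S(X) = f_S⁻¹(a·f_S(X))` lie in `𝒪[S]` — the functional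
equation lemma for `f_S(h) = a · f_S` (`σ(a) = a`). [cite: Hazewinkel1978, §21.4 (21.4.7), §2.2 (ii)] -/
theorem coeff_actK_mem (hA : IsLTRing π q) (hq : 2 ≤ q) (a : 𝒪) (n : ℕ) :
    PowerSeries.coeff n (actK π q hq (MvPolynomial.C (algebraMap 𝒪 (Localization.Away π) a))) ∈ intSubring π := by
  classical
  obtain ⟨p, r, hp, hqpr, w, hw, hpw⟩ := exists_natCast_eq_unif_mul hA
  have hr : 1 ≤ r := by
    rcases Nat.eq_zero_or_pos r with h | h
    · rw [h, pow_zero] at hqpr; omega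
    · exact h
  set c : KS π := MvPolynomial.C (algebraMap 𝒪 (Localization.Away π) a) with hc
  have hh : MvPowerSeries.constantCoeff (actK π q hq c) = 0 := constantCoeff_actK hq c
  have key := coeff_mem_of_feDefect_psubst_mem (intSubring π) (frob π q) unif_mem hp hr (by omega) hqpr (sCoeff π q)
    ⟨w, hw, hpw⟩ (fun a ha => frob_mem ha) (fun a ha => exists_frob_eq_pow_add hA ha)
    (fun i k _ => iterate_frob_sCoeff_mul_unif_mem i k) (logSeries π q) constantCoeff_logSeries (coeff_one_logSeries hq)
    (fun n => by rw [feDefect_logSeries hq n]; exact gCoeff_mem n) hh (fun e => ?_)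
  · rw [PowerSeries.coeff_def (s := Finsupp.single () n) (Finsupp.single_eq_same)]
    exact key _
  · rw [logSeries_subst_actK hq, MvPowerSeries.smul_eq_C_mul, feDefectCoeff_C_mul _ _ _ _ (frob_C _),
      feDefect_logSeries' hq]
    exact (intSubring π).mul_mem (C_algebraMap_mem a) (gCoeff_mem _)

end Integrality

end UnivOModule

end Literature.RingTheory.FormalGroups
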